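import Mathlib
import HarnessLib
import HarnessLib.Audit
import Summits.PneNP.Statement
import Literature.Computability.Complexity.Classes
import Literature.Computability.Complexity.Nondeterministic
import Literature.Computability.Complexity.CookBridges
import Literature.Computability.Complexity.ParityQuantifier
import Literature.Computability.Complexity.ProbabilisticClasses

/-!
Route: RootDecompParityCell

DORMANT since 2026-09-04T15:05:29Z (reconciler: no traction for 5 d (last activity statement-checked at 2026-08-30T13:53:15Z); parked, not closed — `ledger route dormant route-PneNP-RootDecompParityCell --off` to reactivate) — unstaffed, not closed; items shared with open routes are served there. `ledger route dormant <id> --off` reactivates.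

# Route RootDecompParityCell — Root decomposition at the parity cell — P = NP forces P ≠ ⊕P
(transfer), AND P = NP forces ⊕P ⊆ P (the residual)

Root-decomposition cell decomp-pnenp, node N10 «THE ⊕P CELL» (lens-6 gen 4 «ParityShadow»,
HOME/decomp-pnenp-lens-6/ParityShadow.lean sha256
49afe6ed31fe7c9386269739d877f592de70f791ab780d8591a6d7efe4a50440, NODE-g4.md fcb8c3d7…; critic
decomp-pnenp-crit-1 CLEARED 2026-08-30T03:59:14Z + ACK 04:01:30Z:
the generic cell cut along the NEW cut predicate Y = «⊕P ⊆ P», scores ONCE under cap rule (vii); F2: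
new thin route; writer certificate bc/N10_items.lean —
every filed statement is the lens statement by `Iff.rfl`). It suffices to show X = T ∧ R where T =
`ParityTransfer` («if NP ⊆ P then ⊕P ⊄ P: Algorithmica
still cannot count mod 2») and R = `ParityLift` (the DECLARED RESIDUAL: «if NP ⊆ P then ⊕P ⊆ P:
Algorithmica counts mod 2»). The node is the exact frame
S ⟺ T ∧ R of the generic schema `PneNP ↔ Transfer C ∧ Lift C` at C = ⊕P (kernel `summit_iff_split`,
hypothesis-free); N3 (route-PneNP-RootDecompSpaceCeiling)
IS the PP / PSPACE cell of the same schema (`lift_PP_iff : Lift PP ↔ CollapseLift := Iff.rfl`), and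
the kernel edge `parityLift_of_collapseLift` (mod the
tree fact `bp_ParityP_subset_PRelClass_PP`, Toda §4) places R BELOW N3's residual of record
CollapseLift (stmt-PneNP-23703).
Lean: `(Literature.Computability.Complexity.Nondeterministic.NP ⊆
Literature.Computability.Complexity.Classes.P → ¬ (Literature.Computability.Complexity.ParityP ⊆
Literature.Computability.Complexity.Classes.P)) ∧
(Literature.Computability.Complexity.Nondeterministic.NP ⊆
Literature.Computability.Complexity.Classes.P → Literature.Computability.Complexity.ParityP ⊆
Literature.Computability.Complexity.Classes.P)`

## Assembly
Pure logic (kernel `closes`, hypothesis-free, = n10/glue.lean): assume ¬S; then P = NP by Cook's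
shape (`pneNP_shape_iff_P_ne_NP`), so NP ⊆ P; T gives
⊕P ⊄ P and R gives ⊕P ⊆ P — contradiction. Conversely S ⟹ T and S ⟹ R vacuously, so S ⟺ T ∧ R
exactly (`summit_iff_split` = lens `pneNP_iff_parity`).

Rationale: WHY THIS LINE. Generic cell schema (lens-6): for every class C, `PneNP ↔ (NP ⊆ P → ¬ C ⊆ P) ∧ (NP ⊆
P → C ⊆ P)`; the cut is a costume exactly when C ⊆ NP (Lift a theorem) or
¬ C ⊆ P is provable (Transfer a theorem), and ⊕P = Mod₂P (tree `ParityP`, BeigelGill1992) is the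
smallest natural counting class in NEITHER degenerate position
(⊕P ⊆ NP unknown, ⊕P ⊄ P unknown). What it brings: (i) a typed surface on BOTH sides — T and R are
relativization-independent of each other and of S, exhibited
by the Beigel–Maciel 1999 oracle (P = NP, ⊕P = EXP: R false, T true non-vacuously, S false)
[corpus:paper:arxiv-2111.10409 p.33 §6.1] and TQBF (R true, T false,
S false; BakerGillSolovay1975); (ii) a KERNEL EDGE moving the residual DOWN the counting column:
CollapseLift (N3) ⟹ ParityLift via ⊕P ⊆ BP·⊕P ⊆ P^PP ⊆ P^P
(Toda1991 §4; AroraBarak2009 Lemma 17.17/17.22), strictness = census test T20 «a world with P = NP =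
⊕P ≠ PP», answered at pencil level by lens-6 (recursive
NP+⊕P oracle + Razborov–Smolensky, Smolensky1987) and desk-checked by the critic 04:01:30Z (provisos
P1/P2; lit want acq-14854 for BM99 print); (iii) a LAW-D
record one notch ABOVE N3's outright shadow: S ∧ (BPP ⊆ P) ⟹ P ≠ ⊕P via derandomised
Valiant–Vazirani (ValiantVazirani1986, ImpagliazzoWigderson1997; tree fact
`SigmaP_subset_bpExp_ParityP`); (iv) rev 5 — the ⊕P CELL OF THE HUB RESIDUAL (lens-4 g15
«CountingSandwich g15», critic CLEARED 12:45:15Z, hub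
K-cell #4 joined to N10 by name): K = CollapseLift ⟺ ParityLift ∧ ParityCatch mod ParityOfCounting
(aside ParityCellIff, PROVED); BOTH factors are strictly
below K AND two-sided barrier-bound relativized, every certificate decided — ParityLift strict at
T20 (aside TParityLiftStrict, pencil-of-record) / fails at
BM99 (aside TParityCatchStrict, print mod reading); ParityCatch strict at BM99 / fails at T20
(parity fork DISTRIBUTED·DECIDED, cell law (xviii); unlike the
BQP notch of N19 where TQL is open). Imported from structural counting complexity (Toda's theorem,
Beigel–Gill Mod-classes, relativized counting worlds). No prior
PneNP Thesis or cell node (N1–N9) cuts along a parity / Mod_k counting predicate; N3 cuts at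
PP/PSPACE, lens-3's MCSP dial cuts along reductions to MCSP.

RANKED CRUXES. #2 ParityLift (crux) — Piece R = the DECLARED RESIDUAL of the ⊕P cell (lens-6 PIECE
R): if NP ⊆ P then ⊕P ⊆ P — «Algorithmica counts mod 2». WEAKER than S (vacuous under S), NECESSARY,
not a costume (⊕P ⊆ NP unknown; BC7 CLEAN, no R → S in tree or print), UNDECIDED, relativized BOTH
ways (false at the BM99 world P = NP ∧ ⊕P = EXP, true rel. TQBF), IDEA-NEEDED; BELOW the hub
residual K = N3 CollapseLift (23703) by the kernel edge parityLift_of_collapseLift (mod Toda's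
containment = sibling ParityOfCounting); road r2 (print, one folklore step flagged): ¬VH/𝔽₂ ⟹
⊕P/poly small ⟹ … (GKKP11 Thm 9). ‖ rev 5 (lens-4 g15 «⊕P CELL of K», critic CLEARED 12:45:15Z): K ⟺
ParityLift ∧ ParityCatch mod ParityOfCounting (asides ParityCatch; ParityCellIff PROVED) — parity
fork EXACT and DISTRIBUTED·DECIDED: R STRICTLY BELOW K relativized ⟺ test T20, now TYPED as aside
TParityLiftStrict (pencil-positive of record; critic 04:01:30Z provisos P1/P2); R FAILS at BM99,
typed as aside TParityCatchStrict (print mod reading); BARRIER[REL] TWO-SIDED, all certificates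
decided. Residual-of-record-ELECT of the counting chain (critic 04:01:30Z). [difficulty:
open-problem] (why it might fail: FALSE relative to the Beigel–Maciel 1999 oracle (P = NP, ⊕P =
EXP); any proof is non-relativizing and must use NP ⊆ P beyond PH-collapse; the only proved road is
from the STRONGER residual CollapseLift (PP), itself open.) [arXiv:2111.10409, Toda1991,
AroraBarak2009, BeigelGill1992, BakerGillSolovay1975]
#3 ParityTransfer (crux) — Piece T (lens-6 PIECE T): if NP ⊆ P then ⊕P ⊄ P — «Algorithmica still
cannot count mod 2». WEAKER than S (S ⟹ T vacuously), NECESSARY, not a costume (¬ ⊕P ⊆ P is not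
provable today: it is the open P ≠ ⊕P; BC7 CLEAN), UNDECIDED relativized both ways (TQBF kills T;
Beigel–Maciel verifies T with S false), INSTRUMENTABLE / IDEA-NEEDED; dominated by the outright
shadow ParityShadow = P ≠ ⊕P (aside; `transfer_of_shadow`), which is S-implied only modulo VV/Toda-1
and BPP ⊆ P (law-D record `parityShadow_of_summit`); through Toda §4 T implies the transfer of the
PP cell («cannot count mod 2 ⟹ cannot count», lens `transferPP_of_parityTransfer`). Typed decided
rung far below (record, not an item): ModSixRung «Mod₆P ⊄ DTISP(n√n, polylog)» (R. Williams 2008,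
unconditional for composite non-prime-power moduli; quoted via [corpus:paper:galaxy-pdf-2968178060
p.3]). [difficulty: open-problem] (why it might fail: Relative to a PSPACE-complete oracle
everything collapses (BGS75), so T is false there: any proof is non-relativizing (and
non-algebrizing for the outright form P ≠ ⊕P); no circuit or time–space engine reaches polynomial
time for Mod-counting.) [BakerGillSolovay1975, AaronsonWigderson2009, AroraBarak2009,
arXiv:2111.10409, doi:10.1007/s00037-008-0248-y]
#9 ParityShadow (support) — (filed kind ASIDE — record, never staffed; outside the cone of `closes`
under the cell's named-rung rule) the OUTRIGHT SHADOW of the node: ⊕P ⊄ P, i.e. P ≠ ⊕P (P ⊆ ⊕P is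
the tree theorem `ParityClosure.P_subset_ParityP`). LAW-D record: modulo the tree fact
`SigmaP_subset_bpExp_ParityP` (VV86 + parity closure, proved in TodaPartOne) and the open standard
hypothesis BPP ⊆ P (ImpagliazzoWigderson1997), S ⟹ ParityShadow (`parityShadow_of_summit`) — a
«conditional outright shadow» one notch ABOVE N3's unconditional S ⟹ P ≠ PP
(`shadowPP_of_parityShadow` mod Toda-2) and S ⟹ P ≠ PSPACE; ParityShadow ⟹ T trivially and does NOT
give S alone (tribunal T1: not a dominating hypothesis for S). [difficulty: open-problem]
[ValiantVazirani1986, ImpagliazzoWigderson1997, AroraBarak2009, Toda1991]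
#9 ParityOfCounting (support) — (filed kind ASIDE, SUPPORT-DESIGNATE, PROVABLE NOW modulo build: it
is `parityP_subset_P_of_PP_subset_P` of the lens file over the tree fact
`bp_ParityP_subset_PRelClass_PP`, whose sorry-free discharger `bp_ParityP_subset_PRelClass_PP_holds`
lives in TodaPartTwo — olean currently unbuilt on the farm snapshot) Toda's containment step of the
kernel edge: PP ⊆ P ⟹ ⊕P ⊆ P (⊕P ⊆ BP·⊕P ⊆ P^PP ⊆ P^P = P). With N3's CollapseLift it gives R
(`ParityLift_of : ParityOfCounting → CollapseLift → ParityLift`, the BC3 strengthen-to-record line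
for R); becomes support when a registered skeleton of ParityLift names it; any idle prover may land
it as Theorems/RootDecompParityCell/ParityOfCounting.lean once TodaPartTwo builds (or re-prove the
BP·⊕P ⊆ P^PP step inline, AroraBarak2009 Lemma 17.22). [difficulty: provable-now] [Toda1991,
AroraBarak2009]
#2.1/#2.2 (filed rev 3, W1 split of ParityLift cleared by the critic 07:19:32Z; unchanged here)
ParityHorizon (child 1, «NP ⊆ P → ⊕P ≠ EXP») → ParityDichotomy (child 2, «NP ⊆ P → (⊕P ⊆ P ∨ ⊕P =
EXP)», DECLARED RESIDUAL of the split, in tribunal_fit.residual; items stmt-PneNP-30228/30229, glue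
30230) → ParityLift, glue ParityLiftGlue PROVED (exact: parityLift_iff_split).
#9 ParityCatch (support) — (filed kind ASIDE, typed UNDECIDED record, never staffed) NP ⊆ P → PP ⊆
⊕P — the catch coordinate of K at ⊕P: K ⟺ ParityLift ∧ ParityCatch mod ParityOfCounting; STRICTLY
BELOW K relativized (BM99 reading, print) and BARRIER[REL] TWO-SIDED (fails at T20); transfer
reading ParityCatch ↔ (PP ⊄ ⊕P → S); leaf IDEA-NEEDED. [BeigelMaciel1999, arXiv:2111.10409,
Toda1991SIAM, AroraBarak2009]
#9 ParityCellIff (support) — (filed kind ASIDE, PROVED record — lens kernel parityCellIff_holds;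
writer landing file N10g15_landing-g9.lean, landable now) ParityOfCounting → ((NP ⊆ P → PP ⊆ P) ↔
ParityLift ∧ ParityCatch): the ⊕P cell of K is EXACT mod Toda's relativizing containment; K inlined
(= RootDecompSpaceCeiling.CollapseLift by Iff.rfl). [Toda1991SIAM, AroraBarak2009]
#9 TParityLiftStrict (support) — (filed kind ASIDE, typed record = census test T20) ∃ B, NP^B ⊆ P^B
∧ ⊕·P^B ⊆ P^B ∧ PP^B ⊄ P^B — ParityLift STRICTLY BELOW K relativized; PENCIL-POSITIVE OF RECORD
(lens-6 04:00:33Z; critic 04:01:30Z ~0.8, provisos P1/P2), not kernel, not in print as such.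
[arXiv:2111.10409, Razborov1987, Smolensky1987, Jukna2012]
#9 TParityCatchStrict (support) — (filed kind ASIDE, typed record = the Beigel–Maciel reading) ∃ B,
NP^B ⊆ P^B ∧ PP^B ⊄ P^B ∧ PP^B ⊆ ⊕·P^B — ParityCatch STRICTLY BELOW K relativized; DECIDED TRUE IN
PRINT mod the reading (BM99 doi:10.1109/CCC.1999.766280, quoted AIK22 §6.1 p.33; print wanted
acq-14854). [BeigelMaciel1999, arXiv:2111.10409, Toda1991SIAM]

TWO-LAYER PLAN. Foreseen, NOT filed now: R ⇐ ParityOfCounting → CollapseLift (kernel line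
`ParityLift_of`; CollapseLift = N3's item stmt-PneNP-23703, shared by name, not
re-filed); R ⇐ ¬VH/𝔽₂ road (print, GKKP11 Thm 9 + one flagged folklore step ⊕P ⊆ P/poly ⟹ ⊕P ⊆ MA);
T ⇐ ParityShadow (outright P ≠ ⊕P; IDEA-NEEDED). The
Mod-column (Mod_kP ordered by divisibility, BeigelGill1992: `modLift_anti` / `modTransfer_mono`;
Mod₆ row with the unconditional Williams rung) are DIAL
POSITIONS of this node (one-lattice rule), never further nodes. FILED since: the W1 split R ⇐
ParityHorizon → ParityDichotomy (rev 3, glue PROVED) and, rev 5, the record cell K ⟺ R ∧ ParityCatch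
(asides only; no new layer, no new cone binder).

KILL CRITERIA. A refutation of ParityTransfer or of ParityLift refutes P ≠ NP itself (both are
kernel consequences of S) — the route then closes with the summit. A PROOF of
ParityShadow (P ≠ ⊕P outright) makes T a theorem and R ⟺ S: the node is then spent at this cell and
R is handed back to the summit (zero-sum, recorded at
birth); a proof of CollapseLift (N3) proves R by the kernel edge and makes T ⟺ S likewise. T20
resolving NEGATIVELY in print (R ⟺ CollapseLift) merges the
node's residual with N3's (record, not a kill). Rev 5: unchanged — closes is ParityTransfer →
ParityLift → S; the four new asides are census records, never staffed (¬TParityLiftStrict, i.e. T20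
NEGATIVE, would only re-open whether ParityLift ≡ K relativized — a record event, not a kill;
¬TParityCatchStrict would contradict the BM99 reading in print).

NOT DECOMPOSED YET. Which non-relativizing ingredient could prove R from NP ⊆ P beyond the PH
collapse (interactive-proof / arithmetization content of ⊕P: LFKN-type, flagged
non-algebrizing status «AW unknown» for the implication); the 𝔽₂-Valiant road's folklore step; the
exact print form of ModSixRung (Williams 2008 Thm 1.1,
all-but-one-prime clause) — vendoring targets, not items; T20's write-up (census, provisos P1/P2) —
now the typed tree Prop TParityLiftStrict, the ONE pencil item the ⊕P cell leans on; the
BM99 print check of TParityCatchStrict (acq-14854).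

CHEAPEST FALSIFIER. Lookups (lens 03:5xZ + writer 2026-08-30): an oracle with NP ⊆ P = ⊕P and PP ⊄
P, or a theorem «P = NP ⟹ ⊕P = P» / «⊕P ⊆ P ⟹ P = NP» unconditionally, in
print? corpus hybrid + vsearch «oracle relative to which P equals NP and parity P differs» → AIK22
§6.1 quoting BM99 (P = NP ∧ ⊕P = EXP: the OPPOSITE
separation, which is what makes R UNDECIDED) and nothing collapsing ⊕P with NP below PP; galaxy "⊕P
= P|ParityP = P|parity P collapses" --star all → 0
relevant. In-tree: `rg "ParityP ⊆|⊆ ParityP"` over Summits/PneNP finds no (NP ⊆ P → …ParityP…)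
statement; ledger negatives --problem PneNP: no ⊕P row. Rev 5 (lens-4 g15): for the cell's novelty
claim — a RELATIVIZING proof of PP ⊆ ⊕P from NP ⊆ P
would contradict T20 (TParityLiftStrict), and a relativizing proof of ParityLift would contradict
BM99 (TParityCatchStrict): so T20's write-up is the cheapest
live check; lookups for «P = NP ⟹ PP ⊆ ⊕P» in print: none (lens g15 + writer: corpus hybrid/vsearch,
galaxy --star all → 0 relevant).

NUMBERS. Counting column under the collapse NP ⊆ P (Lift side = residuals, ordered DOWN = weaker):
Lift PSPACE (N3 LiftPSpace 23702-side) ⟹ Lift PP = CollapseLift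
(N3 23703, residual of record) ⟹ Lift Mod₆P ⟹ Lift ⊕P = ParityLift (THIS NODE; strictness vs
CollapseLift = T20, pencil-positive 04:00:33Z, critic
provisional 04:01:30Z) ; degenerate below: Lift C a THEOREM for C ⊆ NP (UP, FewP, NP ∩ coNP), Lift
BPP a theorem mod PH-collapse. Transfer side ordered UP.
Decided rung of the Mod-column in print: MOD₆-SAT ∉ DTISP(n^1.8, n^o(1)) (Williams 2008; ceiling of
alternation trading 2cos(π/7) ≈ 1.80, Buss–Williams 2012). ⊕P cell of K (rev 5): K ⟺ Lift ⊕P ∧ Catch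
⊕P; relativized worlds of record — T20 (P = NP = ⊕P, PP ⊄ P: Lift strict, Catch fails;
pencil) and BM99 (P = NP, ⊕P = EXP: Catch strict, Lift fails; print) — 2/2 certificates decided
(N19's BQP cell: 1/2, TQL open).

DEFINITION REQUESTS. `ModP k` (Mod_kP, BeigelGill1992 Def. 2.1; lens typing `{L | ∃ L' ∈ P, ∃ p, ∀
x, x ∈ L ↔ ¬ k ∣ countWitnesses L' (p.eval |x|) x}` with `modP_two_eq_parityP`
proved) and the facts ModP_mono_dvd (Beigel–Gill closure under multiples) and ModSixRung (Williams
2008 Thm 1.1) are VENDORING TARGETS for Literature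
(trunk T-CPLX), to be requested by the census / a typer seat — deliberately NOT items of this route
(critic 04:01:30Z). Build debt: TodaPartOne / TodaPartTwo
oleans (dischargers of the two tree facts used as binders).

Novelty: Searches (2026-08-30, lens-6 g4 + writer): lit search --hybrid "oracle P = NP parity P EXP Beigel
Maciel" (AIK22 arXiv:2111.10409 p.33 hit; BM99 itself not held → acq-14854); lit vsearch «if P
equals NP then parity P equals P» (0 relevant of 8: Arora–Barak ch.17, Toda, Fortnow survey); lit
galaxy search "Beigel-Maciel|parity P = EXP|⊕P = EXP" --star all (0 rows); galaxy "Counting NP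
Solutions Modulo Integers" (1 row: Williams survey pdf-2968178060); corpus hybrid "MODp-SAT time
space lower bound all but one prime" (none); in-tree rg for ParityP statements in
Summits/PneNP/PneNP/Theses (only TodaLadder-type facts in Literature; no thesis).
Nearest prior art found: Toda1991 §4 and AroraBarak2009 Lemma 17.22 (the edge PP ⊆ P ⟹ ⊕P ⊆ P),
ValiantVazirani1986 + ImpagliazzoWigderson1997 (the conditional shadow), BeigelGill1992 (Mod-column
order), arXiv:2111.10409 §6.1 / BM99 (the separating world), in-tree
route-PneNP-RootDecompSpaceCeiling (the PP/PSPACE cell of the same schema).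
Delta: the first decomposition of P ≠ NP cut along a PARITY-COUNTING predicate, with the residual
placed strictly inside the counting column below the PP residual of record by a kernel edge and
separated from it by an explicit relativized world (T20), and a conditional outright shadow P ≠ ⊕P
above P ≠ PP.
Claimed grade: new-combination  [refs: 2111.10409, Toda1991, AroraBarak2009, ValiantVazirani1986, ImpagliazzoWigderson1997, BeigelGill1992]

Barriers (technique_class: counting-classes, law-D-carving): - technique_class: counting-classes, law-D-carving
- Literature.Barriers.PneNP.Relativization: BOTH pieces INSIDE and exhibited both ways (T false rel.
TQBF, true rel. BM99; R the opposite) — no evasion claimed; the bet is that R's proof from NP ⊆ P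
uses arithmetization-type content of ⊕P (LFKN/Toda) that does not relativize.
- Literature.Barriers.PneNP.Algebrization: the outright form P ≠ ⊕P does not algebrize
(TQBF-extension collapse, same placement as P ≠ NP / P ≠ PP, AaronsonWigderson2009 §5); for the
implication R the AW status is UNKNOWN (booked so by lens and critic) — no evasion claimed.
- Literature.Barriers.PneNP.NaturalProofs: does not parse — no circuit lower bound for an explicit
function is claimed by T or R (uniform class statements under a collapse hypothesis); the Mod-column
rung is a uniform time–space bound (alternation trading), outside RR's scope.
- Negatives index: ledger negatives --problem PneNP has no ⊕P / Mod_k / counting-cell statement;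
N3's items (23701–23703) are shared by name only, none refuted.

History (route lifecycle, newest last):
- 2026-08-30T13:03:44Z · rev 5: informal re-worded for ParityLift (planner-decomp-pnenp-writer-1-g9-0)
- 2026-09-04T15:05:29Z · DORMANT — reconciler: no traction for 5 d (last activity statement-checked at 2026-08-30T13:53:15Z); parked, not closed — `ledger route dormant route-PneNP-RootDecompPari (operator:999:2060926)

sub-problem: PneNP · status: dormant · opened planner-decomp-pnenp-writer-1-g3-0 2026-08-30T04:30:19Z · rev 5 · ledger route-PneNP-RootDecompParityCell
GENERATED by the gate from the ledger (D-0016/17). Provers cite these decls: `theorem foo : Summit.PneNP.PneNP.Theses.RootDecompParityCell.<Decl> := …` in Summits/PneNP/PneNP/Theorems/<Name>.lean.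
-/

namespace Summit.PneNP.PneNP.Theses.RootDecompParityCell

open scoped BigOperators Topology Manifold Classical MeasureTheory ProbabilityTheory Matrix InnerProductSpace ComplexConjugate ContinuousMap
open Filter Set Function TopologicalSpace MeasureTheory

attribute [summit_statement] _root_.PneNP

open Literature.PNP

/-- item stmt-PneNP-27750 · crux · rank 2 · SPLIT (gen 1) into ParityHorizon, ParityDichotomy + glue ParityLiftGlue · direct attempts still welcome (low priority) · by planner
why it might fail: FALSE relative to the Beigel–Maciel 1999 oracle (P = NP, ⊕P = EXP); any proof is non-relativizing and must use NP ⊆ P beyond PH-collapse; the only proved road is from the STRONGER residual CollapseLift (PP), itself open.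
sources: arXiv:2111.10409, Toda1991, AroraBarak2009, BeigelGill1992, BakerGillSolovay1975
[crux] Piece R = the DECLARED RESIDUAL of the ⊕P cell (lens-6 PIECE R): if NP ⊆ P then ⊕P ⊆ P —
«Algorithmica counts mod 2». WEAKER than S (vacuous under S), NECESSARY, not a costume (⊕P ⊆ NP
unknown; BC7 CLEAN, no R → S in tree or print), UNDECIDED, relativized BOTH ways (false at the BM99
world P = NP ∧ ⊕P = EXP, true rel. TQBF), IDEA-NEEDED; BELOW the hub residual K = N3 CollapseLift
(23703) by the kernel edge parityLift_of_collapseLift (mod Toda's containment = sibling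
ParityOfCounting); road r2 (print, one folklore step flagged): ¬VH/𝔽₂ ⟹ ⊕P/poly small ⟹ … (GKKP11
Thm 9). ‖ rev 5 (lens-4 g15 «⊕P CELL of K», critic CLEARED 12:45:15Z): K ⟺ ParityLift ∧ ParityCatch
mod ParityOfCounting (asides ParityCatch; ParityCellIff PROVED) — parity fork EXACT and
DISTRIBUTED·DECIDED: R STRICTLY BELOW K relativized ⟺ test T20, now TYPED as aside TParityLiftStrict
(pencil-positive of record; critic 04:01:30Z provisos P1/P2); R FAILS at BM99, typed as aside
TParityCatchStrict (print mod reading); BARRIER[REL] TWO-SIDED, all certificates decided.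
Residual-of-record-ELECT of the counting chain (critic 04:01:30Z). [difficulty: open-problem] -/
@[route_item "route-PneNP-RootDecompParityCell"]
def ParityLift : Prop :=
  Literature.Computability.Complexity.Nondeterministic.NP ⊆ Literature.Computability.Complexity.Classes.P → Literature.Computability.Complexity.ParityP ⊆ Literature.Computability.Complexity.Classes.P

-- parent: ParityLift · child (gen 1)
/--     item stmt-PneNP-30228 · crux · rank 201 · open
    parent: ParityLift · by planner
    why it might fail: False exactly in BM99-type worlds made real: P = NP together with ⊕P = EXP is consistent relative to an oracle (Beigel–Maciel 1999), so only a non-relativizing argument can prove H⊕; its S-free roads (⊕P ≠ EXP, PSPACE ≠ EXP) are flagship open separations.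
    sources: arXiv:2111.10409, BeigelMaciel1999, Book1974, HOME/decomp-pnenp-lens-6/ExpHorizon.lean sha256 4c7e609b
[crux] H⊕ «in Algorithmica parity counting is not everything exponential time does»: NP ⊆ P → ⊕P ≠
EXP — CHILD 1 of ParityLift (stmt-PneNP-27750) in the W1 SPLIT cleared by critic decomp-pnenp-crit-1
g4 2026-08-30T07:19:32Z on lens-6 g8 «ExpHorizon» (HOME/decomp-pnenp-lens-6/ExpHorizon.lean sha256
4c7e609b, NODE-g8.md d2cb566e): the UP-cut of N10's residual R⊕ along Y = «⊕P = EXP», simplified by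
P ≠ EXP (tree time hierarchy): R⊕ ⟺ H⊕ ∧ D⊕ (kernel `parityLift_iff_split`, hypothesis-free). Scores
ONCE (vii) for the new coordinate «position vs EXP» (typed generically for every class cell;
BQP/PP/P^PP/PSPACE horizon cells LOGGED as instances). TAGS: WEAKER (formal child of 27750; strict
relative to TQBF: H⊕ ∧ ¬S) · NEC · not COSTUME · UNDECIDED (BM99's world P = NP ∧ ⊕P = EXP refutes
every relativizing proof [corpus:paper:arxiv-2111.10409 p.33]; TQBF refutes every relativizing
refutation) · H⊕ < R⊕ strictness = a₃-world PENCIL (census test T_g8) · leaf IDEA-NEEDED /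
INSTRUMENTABLE: S-free roads ⊕P ≠ EXP / P^PP ≠ EXP / PSPACE ≠ EXP (mod the Toda §4 binder h2 as in
N10; kernel disjunction N3.ShadowPSpace 23701 ∨ PSPACE ≠ EXP), rungs in kernel horizon_NP /
horizon_BPP / P_ne_EXP, print ru -/
@[route_item "route-PneNP-RootDecompParityCell"]
def ParityHorizon : Prop :=
  Literature.Computability.Complexity.Nondeterministic.NP ⊆ Literature.Computability.Complexity.Classes.P → Literature.Computability.Complexity.ParityP ≠ Literature.Computability.Complexity.EXP

-- parent: ParityLift · child (gen 1)
/--     item stmt-PneNP-30229 · crux · rank 202 · open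
    parent: ParityLift · by planner
    why it might fail: False exactly in an a₃-world «P = NP with ⊕P strictly between P and EXP»; such a world is pencil-consistent relative to an oracle (KQST22-type constructions), so D⊕ needs a non-relativizing proof and may simply be false if parity counting in Algorithmica is intermediate.
    sources: arXiv:2111.10409, BeigelMaciel1999, Toda1991, HOME/decomp-pnenp-lens-6/ExpHorizon.lean sha256 4c7e609b
[crux] D⊕ «in Algorithmica parity counting is trivial or maximal»: NP ⊆ P → (⊕P ⊆ P ∨ ⊕P = EXP) —
CHILD 2 of ParityLift (27750), DECLARED RESIDUAL of the split (critic 07:19:32Z: BOOKED as the new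
BOTTOM of the ⊕P column L 23705 ⟹ K 23703 ⟹(h2) R⊕ 27750 ⟹ D⊕, residual of record of that column,
print-relativized; D⊕ ⟸ R⊕ binder-free (kernel `parityDichotomy_of_parityLift`) and STRICTLY: BM99
gives D⊕ ∧ ¬R⊕ [corpus:paper:arxiv-2111.10409 p.33]). TAGS: WEAKER (strict rel. TQBF and BM99: D⊕ ∧
¬S) · NEC · not COSTUME · UNDECIDED (census test T_g8: the a₃-world «P = NP, P ⊊ ⊕P ≠ EXP», pencil
KQST22 Def 18/Prop 19/Lemma 37 + Håstad + Razborov–Smolensky) · carries the column's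
S-inert-with-expected-side tag (pre-costume trigger = the TWO separations P ≠ ⊕P ∧ ⊕P ≠ EXP, i.e.
aside M⊕'s road) · leaf IDEA-NEEDED · BARRIER relativization. Glue item of the split: ParityHorizon
→ ParityDichotomy → ParityLift (kernel `parityLift_of_split`, 3 lines, proved in the writer
certificate; exact: `parityLift_iff_split`). tribunal_fit.residual += this decl (FQ). [difficulty:
open-problem] -/
@[route_item "route-PneNP-RootDecompParityCell"]
def ParityDichotomy : Prop :=
  Literature.Computability.Complexity.Nondeterministic.NP ⊆ Literature.Computability.Complexity.Classes.P → (Literature.Computability.Complexity.ParityP ⊆ Literature.Computability.Complexity.Classes.P ∨ Literature.Computability.Complexity.ParityP = Literature.Computability.Complexity.EXP)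

-- parent: ParityLift · glue (gen 1)
/--     item stmt-PneNP-30230 · support · rank 203 · closed · proved by Summit.PneNP.PneNP.Theorems.parityLiftGlue_proof (prover)
    parent: ParityLift · GLUE: children ⟹ parent · by planner
W1 glue of the ExpHorizon split (lens-6 g8 kernel `parityLift_of_split`, hypothesis-free, 3 lines:
from hD hNP either ⊕P ⊆ P (done) or ⊕P = EXP, contradicting hH hNP; exact — `parityLift_iff_split :
ParityLift ↔ ParityHorizon ∧ ParityDichotomy`); proved in the writer certificate
n10_split/N10s_items.lean (rc0, axioms propext/choice/Quot.sound) -/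
@[route_item "route-PneNP-RootDecompParityCell"]
def ParityLiftGlue : Prop :=
  ParityHorizon → ParityDichotomy → ParityLift

-- `ParityLiftGlue` holds: proved by `Summit.PneNP.PneNP.Theorems.parityLiftGlue_proof` (its module imports this route file, so no `_holds` link can be stated here).

/-- item stmt-PneNP-27751 · crux · rank 3 · open · by planner
why it might fail: Relative to a PSPACE-complete oracle everything collapses (BGS75), so T is false there: any proof is non-relativizing (and non-algebrizing for the outright form P ≠ ⊕P); no circuit or time–space engine reaches polynomial time for Mod-counting.
sources: BakerGillSolovay1975, AaronsonWigderson2009, AroraBarak2009, arXiv:2111.10409, doi:10.1007/s00037-008-0248-y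
[crux] Piece T (lens-6 PIECE T): if NP ⊆ P then ⊕P ⊄ P — «Algorithmica still cannot count mod 2».
WEAKER than S (S ⟹ T vacuously), NECESSARY, not a costume (¬ ⊕P ⊆ P is not provable today: it is the
open P ≠ ⊕P; BC7 CLEAN), UNDECIDED relativized both ways (TQBF kills T; Beigel–Maciel verifies T
with S false), INSTRUMENTABLE / IDEA-NEEDED; dominated by the outright shadow ParityShadow = P ≠ ⊕P
(aside; `transfer_of_shadow`), which is S-implied only modulo VV/Toda-1 and BPP ⊆ P (law-D record
`parityShadow_of_summit`); through Toda §4 T implies the transfer of the PP cell («cannot count mod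
2 ⟹ cannot count», lens `transferPP_of_parityTransfer`). Typed decided rung far below (record, not
an item): ModSixRung «Mod₆P ⊄ DTISP(n√n, polylog)» (R. Williams 2008, unconditional for composite
non-prime-power moduli; quoted via [corpus:paper:galaxy-pdf-2968178060 p.3]). [difficulty:
open-problem] -/
@[route_item "route-PneNP-RootDecompParityCell"]
def ParityTransfer : Prop :=
  Literature.Computability.Complexity.Nondeterministic.NP ⊆ Literature.Computability.Complexity.Classes.P → ¬ (Literature.Computability.Complexity.ParityP ⊆ Literature.Computability.Complexity.Classes.P)

/-- item stmt-PneNP-27752 · aside · rank 9 · open · by planner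
sources: ValiantVazirani1986, ImpagliazzoWigderson1997, AroraBarak2009, Toda1991
[support] (filed kind ASIDE — record, never staffed; outside the cone of `closes` under the cell's
named-rung rule) the OUTRIGHT SHADOW of the node: ⊕P ⊄ P, i.e. P ≠ ⊕P (P ⊆ ⊕P is the tree theorem
`ParityClosure.P_subset_ParityP`). LAW-D record: modulo the tree fact `SigmaP_subset_bpExp_ParityP`
(VV86 + parity closure, proved in TodaPartOne) and the open standard hypothesis BPP ⊆ P
(ImpagliazzoWigderson1997), S ⟹ ParityShadow (`parityShadow_of_summit`) — a «conditional outright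
shadow» one notch ABOVE N3's unconditional S ⟹ P ≠ PP (`shadowPP_of_parityShadow` mod Toda-2) and S
⟹ P ≠ PSPACE; ParityShadow ⟹ T trivially and does NOT give S alone (tribunal T1: not a dominating
hypothesis for S). [difficulty: open-problem] -/
@[route_item "route-PneNP-RootDecompParityCell"]
def ParityShadow : Prop :=
  ¬ (Literature.Computability.Complexity.ParityP ⊆ Literature.Computability.Complexity.Classes.P)

/-- item stmt-PneNP-27753 · aside · rank 9 · open · by planner
sources: Toda1991, AroraBarak2009
[support] (filed kind ASIDE, SUPPORT-DESIGNATE, PROVABLE NOW modulo build: it is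
`parityP_subset_P_of_PP_subset_P` of the lens file over the tree fact
`bp_ParityP_subset_PRelClass_PP`, whose sorry-free discharger `bp_ParityP_subset_PRelClass_PP_holds`
lives in TodaPartTwo — olean currently unbuilt on the farm snapshot) Toda's containment step of the
kernel edge: PP ⊆ P ⟹ ⊕P ⊆ P (⊕P ⊆ BP·⊕P ⊆ P^PP ⊆ P^P = P). With N3's CollapseLift it gives R
(`ParityLift_of : ParityOfCounting → CollapseLift → ParityLift`, the BC3 strengthen-to-record line
for R); becomes support when a registered skeleton of ParityLift names it; any idle prover may land
it as Theorems/RootDecompParityCell/ParityOfCounting.lean once TodaPartTwo builds (or re-prove the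
BP·⊕P ⊆ P^PP step inline, AroraBarak2009 Lemma 17.22). [difficulty: provable-now] -/
@[route_item "route-PneNP-RootDecompParityCell"]
def ParityOfCounting : Prop :=
  Literature.Computability.Complexity.PP ⊆ Literature.Computability.Complexity.Classes.P → Literature.Computability.Complexity.ParityP ⊆ Literature.Computability.Complexity.Classes.P

/-- item stmt-PneNP-33243 · aside · rank 9 · open · by planner
sources: BeigelMaciel1999, arXiv:2111.10409, AaronsonIngramKretschmer2022, Toda1991SIAM, AroraBarak2009, HOME/decomp-pnenp-lens-4/g15/N10g15_items.lean
[aside] ParityCatch «in Algorithmica parity counting catches majority counting»: NP ⊆ P → PP ⊆ ⊕P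
(typed UNDECIDED record; never staffed). CATCH coordinate of the hub residual K =
RootDecompSpaceCeiling.CollapseLift (23703) at ⊕P (lens-4 g15, hub K-cell #4; critic CLEARED
12:45:15Z): K ⟺ ParityLift ∧ ParityCatch mod ParityOfCounting — sibling ParityCellIff, PROVED; K →
ParityCatch hyp-free over the tree theorem P ⊆ ⊕P. TAGS: WEAKER · NECESSARY · NOT COSTUME (given
ParityLift it IS K) · STRICTLY BELOW K relativized — DECIDED in print mod the reading of
Beigel–Maciel 1999 «P = NP ∧ ⊕P = EXP» (there PP ⊆ EXP = ⊕P, PP ⊄ P; quoted AIK22 arXiv:2111.10409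
§6.1 p.33; sibling TParityCatchStrict; print wanted acq-14854) · BARRIER[REL] TWO-SIDED — DECIDED
mod test T20 = sibling TParityLiftStrict (there PP ⊄ P = ⊕P: the catch FAILS) · NEITHER factor of K
at ⊕P relativizes and, unlike N19's BQP notch (TQL open), every relativized certificate here is
decided · transfer reading ParityCatch ↔ (PP ⊄ ⊕P → S) · leaf IDEA-NEEDED (non-relativizing handle
on ⊕P in print: arithmetization). Certificate lens-4/g15/N10g15_items.lean 98fe48bb. -/
@[route_item "route-PneNP-RootDecompParityCell"]
def ParityCatch : Prop :=
  Literature.Computability.Complexity.Nondeterministic.NP ⊆ Literature.Computability.Complexity.Classes.P → Literature.Computability.Complexity.PP ⊆ Literature.Computability.Complexity.ParityP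

/-- item stmt-PneNP-33244 · aside · rank 9 · closed · proved by Summit.PneNP.PneNP.Theorems.parityCellIff_proof (prover) · by planner
sources: Toda1991SIAM, AroraBarak2009, HOME/decomp-pnenp-lens-4/g15/N10g15_items.lean, HOME/decomp-pnenp-lens-4/CountingSandwich-g15.lean, HOME/decomp-pnenp-writer-1/N10g15_landing-g9.lean, HOME/decomp-pnenp-writer-1/N10g15_items-g9.lean
[aside] ParityCellIff — PROVED record (lens-4 g15 kernel parityCellIff_holds, 0 sorry, axioms
standard; critic CLEARED 12:45:15Z; writer landing file
HOME/decomp-pnenp-writer-1/N10g15_landing-g9.lean, theorem parityCellIff_proof typed BY THIS DECL —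
any lander: ledger propose --kind proof --target
Summits/PneNP/PneNP/Theorems/RootDecompParityCellParityCellIff.lean --workitem <this item>):
ParityOfCounting → ((NP ⊆ P → PP ⊆ P) ↔ ParityLift ∧ ParityCatch). The ⊕P cell of the hub residual K
is EXACT modulo Toda's relativizing containment ParityOfCounting (27753, provable-now / port-owed) —
used for K → ParityLift only; K → ParityCatch is the tree theorem P ⊆ ⊕P
(ParityClosure.P_subset_ParityP); the converse ParityLift ∧ ParityCatch → K is two transitivity
steps (collapseLift_of_parityPieces, hyp-free). K is INLINED exactly as N19's QCellIff inlines it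
(route files do not import each other; parityCellIff_byName : … ↔ (ParityOfCounting →
(RootDecompSpaceCeiling.CollapseLift ↔ …)) is Iff.rfl). Joins N10 to hub K-cell #4 (critic
11:28:01Z) by name; never touches S; closes / cone of N10 unchanged. -/
@[route_item "route-PneNP-RootDecompParityCell"]
def ParityCellIff : Prop :=
  ParityOfCounting → ((Literature.Computability.Complexity.Nondeterministic.NP ⊆ Literature.Computability.Complexity.Classes.P → Literature.Computability.Complexity.PP ⊆ Literature.Computability.Complexity.Classes.P) ↔ (ParityLift ∧ ParityCatch))

-- `ParityCellIff` holds: proved by `Summit.PneNP.PneNP.Theorems.parityCellIff_proof` (its module imports this route file, so no `_holds` link can be stated here).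

/-- item stmt-PneNP-33245 · aside · rank 9 · open · by planner
sources: arXiv:2111.10409, AaronsonIngramKretschmer2022, Razborov1987, Smolensky1987, Jukna2012, HOME/decomp-pnenp-lens-4/g15/N10g15_items.lean
[aside] TEST T_PL = census test T20 TYPED (record; never staffed; critic CLEARED 12:45:15Z): ∃ B
with NP^B ⊆ P^B, ⊕·P^B ⊆ P^B and PP^B ⊄ P^B — «a collapsing world where parity counting is easy but
majority counting is not» = the statement that ParityLift (27750) is STRICTLY BELOW K relativized
(lens-4 kernel strictBelowK_parityLift_iff_TPL) and, by zero-sum, a world where ParityCatch FAILS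
(tParityCatchBound_of_tParityLiftStrict). STATUS: PENCIL-POSITIVE OF RECORD, not kernel, not in
print as such — lens-6 g4 04:00:33Z (HRS22/AIK Thm-29 template: ⊕P- and NP-coding regions, each
coded bit an AC⁰[⊕] function of the free region by bottom-up unrolling [AIK22 Lemma 32 p.20, NP half
in print], MAJORITY of the free region ∉ P^O by Razborov–Smolensky [Jukna 2012 Thm 12.24 p.366]);
critic desk-check 04:01:30Z credible ~0.8 with provisos P1 (⊕P-halves of the unrolling lemma need a
write-up) and P2 (measure-one vs countable-intersection diagonalisation). Deciding it in print would
make ParityLift's strictness kernel-grade modulo a binder, as AIK22 Thm 10 did for QLift's failure. -/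
@[route_item "route-PneNP-RootDecompParityCell"]
def TParityLiftStrict : Prop :=
  ∃ B : Language Bool, Literature.Computability.Complexity.NPRel (Literature.Computability.Complexity.Oracle.ofLanguage B) ⊆ Literature.Computability.Complexity.PRel (Literature.Computability.Complexity.Oracle.ofLanguage B) ∧ Literature.Computability.Complexity.pParity (Literature.Computability.Complexity.PRel (Literature.Computability.Complexity.Oracle.ofLanguage B)) ⊆ Literature.Computability.Complexity.PRel (Literature.Computability.Complexity.Oracle.ofLanguage B) ∧ ¬ (Literature.Computability.Complexity.PPRel (Literature.Computability.Complexity.Oracle.ofLanguage B) ⊆ Literature.Computability.Complexity.PRel (Literature.Computability.Complexity.Oracle.ofLanguage B))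

/-- item stmt-PneNP-33246 · aside · rank 9 · open · by planner
sources: BeigelMaciel1999, arXiv:2111.10409, AaronsonIngramKretschmer2022, Toda1991SIAM, HOME/decomp-pnenp-lens-4/g15/N10g15_items.lean, HOME/decomp-pnenp-lens-4/CountingSandwich-g15.lean
[aside] TEST T_PS = the Beigel–Maciel reading TYPED (record; never staffed; critic CLEARED
12:45:15Z): ∃ B with NP^B ⊆ P^B, PP^B ⊄ P^B and PP^B ⊆ ⊕·P^B — «a collapsing world where parity
counting catches majority counting but counting stays hard» = the statement that ParityCatch is
STRICTLY BELOW K relativized (lens-4 kernel strictBelowK_parityCatch_iff_TPS) and, by zero-sum, a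
world where ParityLift FAILS (tParityLiftBound_of_tParityCatchStrict; = ParityLift's recorded «false
at BM99»). STATUS: DECIDED TRUE IN PRINT modulo the reading: Beigel–Maciel 1999 (CCC'99,
doi:10.1109/CCC.1999.766280) construct an oracle with P = NP and ⊕P = EXP [quoted verbatim in AIK22
arXiv:2111.10409 §6.1 p.33]; relative to it PP ⊆ EXP = ⊕P (PP ⊆ PSPACE ⊆ EXP relativizes) and PP ⊄ P
(else ⊕P ⊆ P^PP = P by Toda's relativizing containment, contradicting ⊕P = EXP ≠ P by the
relativizing time hierarchy). Print confirmation of BM99's exact statement wanted: acq-14854 (filed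
by lens-6). -/
@[route_item "route-PneNP-RootDecompParityCell"]
def TParityCatchStrict : Prop :=
  ∃ B : Language Bool, Literature.Computability.Complexity.NPRel (Literature.Computability.Complexity.Oracle.ofLanguage B) ⊆ Literature.Computability.Complexity.PRel (Literature.Computability.Complexity.Oracle.ofLanguage B) ∧ ¬ (Literature.Computability.Complexity.PPRel (Literature.Computability.Complexity.Oracle.ofLanguage B) ⊆ Literature.Computability.Complexity.PRel (Literature.Computability.Complexity.Oracle.ofLanguage B)) ∧ Literature.Computability.Complexity.PPRel (Literature.Computability.Complexity.Oracle.ofLanguage B) ⊆ Literature.Computability.Complexity.pParity (Literature.Computability.Complexity.PRel (Literature.Computability.Complexity.Oracle.ofLanguage B))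

/-- item stmt-PneNP-27754 · assembly · rank 1 · open · by planner
sources: CookClay2006, AroraBarak2009
[assembly] ParityTransfer → ParityLift → P ≠ NP. -/
@[route_item "route-PneNP-RootDecompParityCell"]
def Assembly : Prop :=
  ParityTransfer → ParityLift → PneNP

/-! D-0027 §2.1 — DECIDING THEOREM (planner-authored via `route open/edit --closes-file`; by planner-decomp-pnenp-writer-1-g3-0 2026-08-30T04:30:19Z):
its hypotheses are this route's items and its conclusion the sub-problem Statement (glue_lint), and it elaborates with this file. -/

@[closes "route-PneNP-RootDecompParityCell"] theorem closes (hT : ParityTransfer) (hR : ParityLift) : _root_.PneNP := by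
  by_contra hS
  have key : _root_.PneNP ↔ Literature.Computability.Complexity.Classes.P ≠ Literature.Computability.Complexity.Nondeterministic.NP :=
    Literature.Computability.Complexity.pneNP_shape_iff_P_ne_NP
  have heq : Literature.Computability.Complexity.Classes.P = Literature.Computability.Complexity.Nondeterministic.NP :=
    not_not.1 (fun hne => hS (key.2 hne))
  exact hT heq.symm.subset (hR heq.symm.subset)

end Summit.PneNP.PneNP.Theses.RootDecompParityCell
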